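import Summits.KontsevichZagierPeriods.KontsevichZagierPeriods.Statement
import Summits.KontsevichZagierPeriods.KontsevichZagierPeriods.Theses.TorsionLogs
import Literature.NumberTheory.Transcendental.KZKernelConjectureForms
import Literature.NumberTheory.Transcendental.KZProductIdeal
import Mathlib

/-!
# F4 ON-PATH LEMMA for the rung `NeronTorsionLengths` (line `NeronTorsionDepthThree` on crux `TorsionSectorComplete`,
# stmt-KontsevichZagierPeriods-14212; forward generator G1 `next-rung`, gen 11, seed g1-KontsevichZagierPeriods-17981)

`theorem onPath : KontsevichZagierPeriods → NeronTorsionLengths` — the summit implies the rung.  Member `false` (the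
floor) is a theorem outright (`Theses.TorsionLogs.NeronTorsionPrimitiveChain_holds`); member `true` (the tied
length-three sector statement) follows from Conjecture 1 in kernel form (`kzKernelConjecture_iff_isRational`): the
element evaluates, by `KZ.eval_of` and the product rule `KZ.eval_mul'`, to the value hypothesis, hence lies in
`ker eval = relations`.  No `sorry`.  Self-contained: verbatim copies of the three `def`s of
`Lines/NeronTorsionDepthThree.lean` in the namespace `…NeronTorsionDepthThree.OnPath`; the `@[simp]` hypothesis-form
theorem is the shape the tribunal's forward probe `S → Rung` closes with. [cite: KontsevichZagier2001, §1.2]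
-/

noncomputable section

-- `Summit.KontsevichZagierPeriods.KontsevichZagierPeriods.…` is the tree's mandated layout (single-conjunct summit).
set_option linter.dupNamespace false

namespace Summit.KontsevichZagierPeriods.KontsevichZagierPeriods.Cruxes.TorsionSectorComplete.NeronTorsionDepthThree.OnPath

open Literature.NumberTheory.Transcendental
open Summit.KontsevichZagierPeriods.KontsevichZagierPeriods.Theses.TorsionLogs (NeronTorsionPrimitiveChain
  NeronTorsionPrimitiveChain_holds)

/-- Verbatim copy of `Lines/NeronTorsionDepthThree.lean :: NeronTorsionDepthThreeSector` (member `true`, ℓ = 3). -/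
def NeronTorsionDepthThreeSector : Prop :=
  ∀ (g₂ g₃ e₁ xP yP B : ℝ) (N a : ℕ) (c : ℤ) (f : ℝ → ℝ),
    (∀ x, f x = 4 * x ^ 3 - g₂ * x - g₃) → g₂ ^ 3 - 27 * g₃ ^ 2 ≠ 0 → f e₁ = 0 → 0 < e₁ →
    (∀ x, e₁ < x → 0 < f x) → e₁ < xP → yP ^ 2 = f xP → 3 ≤ N → 0 < a → 2 * a < N →
    (∀ hns : (⟨0, 0, 0, -g₂ / 4, -g₃ / 4⟩ : WeierstrassCurve ℝ).toAffine.Nonsingular xP (yP / 2),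
      addOrderOf (WeierstrassCurve.Affine.Point.some xP (yP / 2) hns) = N) →
    (N : ℝ) * (∫ x in Set.Ioi xP, (Real.sqrt (f x))⁻¹) = a * (2 * ∫ x in Set.Ioi e₁, (Real.sqrt (f x))⁻¹) →
    1 < B →
    ∀ (r3P r3O : KZ.IntegralRep 3) (rJp rJm : KZ.IntegralRep 2) (rEta rA rB : KZ.IntegralRep 1),
    r3P.domain = {z | e₁ < z 2 ∧ z 2 < z 1 ∧ z 1 < z 0 ∧ z 0 < xP} →
    Set.EqOn r3P.integrand
      (fun z => z 2 / (Real.sqrt (f (z 2)) * Real.sqrt (f (z 1)) * Real.sqrt (f (z 0)))) r3P.domain →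
    r3O.domain = {z | e₁ < z 2 ∧ z 2 < z 1 ∧ z 1 < z 0} →
    Set.EqOn r3O.integrand
      (fun z => z 2 / (Real.sqrt (f (z 2)) * Real.sqrt (f (z 1)) * Real.sqrt (f (z 0)))) r3O.domain →
    rJp.domain = {z | xP < z 0 ∧ 1 < z 1 ∧
      z 1 < ((⟨0, 0, 0, -g₂ / 4, -g₃ / 4⟩ : WeierstrassCurve ℝ).ΨSq N).eval (z 0)} →
    Set.EqOn rJp.integrand (fun z => (z 1)⁻¹ * (Real.sqrt (f (z 0)))⁻¹) rJp.domain →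
    rJm.domain = {z | xP < z 0 ∧
      ((⟨0, 0, 0, -g₂ / 4, -g₃ / 4⟩ : WeierstrassCurve ℝ).ΨSq N).eval (z 0) < z 1 ∧ z 1 < 1} →
    Set.EqOn rJm.integrand (fun z => (z 1)⁻¹ * (Real.sqrt (f (z 0)))⁻¹) rJm.domain →
    rEta.domain = {t | e₁ < t 0} →
    Set.EqOn rEta.integrand (fun t => (g₂ * t 0 + 2 * g₃) / (2 * (t 0) ^ 2 * Real.sqrt (f (t 0)))) rEta.domain →
    rA.domain = {t | e₁ < t 0} → Set.EqOn rA.integrand (fun t => (Real.sqrt (f (t 0)))⁻¹) rA.domain →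
    rB.domain = {t | 1 < t 0 ∧ t 0 < B} → Set.EqOn rB.integrand (fun t => (t 0)⁻¹) rB.domain →
    12 * (N : ℝ) ^ 3 * r3P.value - 12 * ((N : ℝ) ^ 3 - 2 * a) * r3O.value
      + 6 * (N : ℝ) * (rJp.value - rJm.value)
      - 2 * a * (4 * (a : ℝ) ^ 2 - 6 * a * N + 3 * (N : ℝ) ^ 2 - 1) * (rEta.value * rA.value * rA.value)
      - c * (rA.value * rB.value) = 0 →
    (12 * (N : ℤ) ^ 3) • KZ.of r3P - (12 * ((N : ℤ) ^ 3 - 2 * a)) • KZ.of r3O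
      + (6 * (N : ℤ)) • (KZ.of rJp - KZ.of rJm)
      - (2 * (a : ℤ) * (4 * (a : ℤ) ^ 2 - 6 * a * N + 3 * (N : ℤ) ^ 2 - 1)) • (KZ.of rEta * KZ.of rA * KZ.of rA)
      - c • (KZ.of rA * KZ.of rB) ∈ KZ.relations

/-- Verbatim copy of `Lines/NeronTorsionDepthThree.lean :: NeronTorsionLengthMember` (the family, graded by ℓ). -/
def NeronTorsionLengthMember : Bool → Prop
  | false => NeronTorsionPrimitiveChain
  | true => NeronTorsionDepthThreeSector

/-- Verbatim copy of `Lines/NeronTorsionDepthThree.lean :: NeronTorsionLengths` (THE RUNG). -/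
def NeronTorsionLengths : Prop := ∀ three : Bool, NeronTorsionLengthMember three

/-- **The summit implies the new member** (Conjecture 1, kernel form). -/
@[simp] theorem depthThreeSector_of_kontsevichZagierPeriods (h : _root_.KontsevichZagierPeriods) :
    NeronTorsionDepthThreeSector := by
  have hK : KZKernelConjecture := kzKernelConjecture_iff_isRational.mpr h
  intro g₂ g₃ e₁ xP yP B N a c f _ _ _ _ _ _ _ _ _ _ _ _ _ r3P r3O rJp rJm rEta rA rB _ _ _ _ _ _ _ _ _ _ _ _ _ _ hval
  apply hK
  simp only [map_sub, map_add, map_zsmul, KZ.eval_mul', KZ.eval_of, zsmul_eq_mul]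
  push_cast
  linear_combination hval

/-- **F4 ON-PATH (hypothesis form, `@[simp]`): the summit implies the rung.** -/
@[simp] theorem neronTorsionLengths_of_kontsevichZagierPeriods (h : _root_.KontsevichZagierPeriods) :
    NeronTorsionLengths := by
  rintro (_ | _)
  · exact NeronTorsionPrimitiveChain_holds
  · exact depthThreeSector_of_kontsevichZagierPeriods h

/-- **F4 ON-PATH LEMMA** in the literal shape `S → Rung`. -/
theorem onPath : _root_.KontsevichZagierPeriods → NeronTorsionLengths :=
  neronTorsionLengths_of_kontsevichZagierPeriods

end Summit.KontsevichZagierPeriods.KontsevichZagierPeriods.Cruxes.TorsionSectorComplete.NeronTorsionDepthThree.OnPath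

end
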